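import Mathlib

/-!
# T5DegreeOneQuotient — the finite quotients `R ⧸ P ^ n` at a degree-one prime are `ZMod (p ^ n)`

Tier-5 kernel support (seat p7) for route/T5-LEAN-p7.md §22, fourth addendum: the last reading of
print left in clause (b)(iv) — «the completion of `F` at a degree-one prime `𝔭` is `ℚ_p`» — is made
a theorem by a chain of Mathlib-only files of which this is the first, the FINITE LAYERS
`R ⧸ 𝔭 ^ n = ℤ ⧸ p ^ n ℤ`.

Setting: `R` a Dedekind domain, `P` a non-zero prime ideal of `R`, `p` a rational prime such that
* `(p : R) ∈ P` and `(p : R) ∉ P ^ 2` — the ramification index `e(P | p)` is `1`, and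
* every class of `R ⧸ P` contains a rational integer — the inertia degree `f(P | p)` is `1`.

Results:
* `intValuation_natCast_eq` / `intValuation_natCast_pow`: the `P`-adic valuation of `p ^ n` is
  exactly `exp (-n)`; `pow_notMem_pow_succ`: `p ^ n ∉ P ^ (n + 1)`;
* `exists_int_sub_mem_pow`: `ℤ → R ⧸ P ^ n` is surjective for every `n` (induction on Mathlib's
  `Ideal.exists_mul_add_mem_pow_succ`, Neukirch I.6.1);
* `intCast_mem_pow_iff`: for `a : ℤ`, `(a : R) ∈ P ^ n ↔ p ^ n ∣ a` — the kernel is `p ^ n ℤ`;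
* `charP_quot_pow`: `R ⧸ P ^ n` has characteristic `p ^ n`; `zmodToQuot n : ZMod (p ^ n) →+* R ⧸ P ^ n`
  is bijective; `quotPowEquivZMod n : R ⧸ P ^ n ≃+* ZMod (p ^ n)`; `natCard_quot_pow`;
* bridging lemmas reading the hypotheses off Mathlib's vocabulary: `natCast_mem_of_liesOver`
  (`p ∈ P` from `P.LiesOver (span {p})`), `not_mem_sq_of_ramificationIdx_eq_one`
  (`P.ramificationIdx ℤ = 1 ⇒ p ∉ P ^ 2`, via `IsDedekindDomain.ramificationIdx_eq_multiplicity`),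
  `exists_int_sub_mem_of_inertiaDeg_eq_one` (`P.inertiaDeg ℤ = 1 ⇒ ℤ → R ⧸ P` surjective, via
  `Ideal.inertiaDeg_eq_of_isMaximal` and `finrank = 1`).

Design: the hypotheses are stated in elementary form (membership of `p` in `P` and `P ^ 2`,
surjectivity onto the residue field), so that the chain needs neither `Module.Free ℤ R` nor
`Module.Finite ℤ R`; the only definitions are the ring map `zmodToQuot` and the isomorphism
`quotPowEquivZMod`. Nothing about the cell's datum (the sextic CM field, the chosen prime) is
declared here; the instantiation at a number field is the last file of the chain.
-/

namespace Summit.Ventures.HodgeRepro2.T5DegreeOneQuotient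

open Ideal WithZero IsDedekindDomain

variable {R : Type*} [CommRing R] [IsDedekindDomain R] {P : Ideal R} [hP : P.IsPrime] {p : ℕ}

section Valuation

variable (hP0 : P ≠ ⊥) (hpP : (p : R) ∈ P) (hpP2 : (p : R) ∉ P ^ 2)
include hP0 hpP hpP2

/-- The `P`-adic valuation of `p` is exactly `exp (-1)` when `p ∈ P ∖ P ^ 2`
(`HeightOneSpectrum.intValuation` of the height-one prime `⟨P, _, _⟩`). -/
theorem intValuation_natCast_eq :
    (⟨P, hP, hP0⟩ : HeightOneSpectrum R).intValuation (p : R) = exp (-1 : ℤ) := by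
  set v : HeightOneSpectrum R := ⟨P, hP, hP0⟩ with hv
  have hvP : v.asIdeal = P := rfl
  have h1 : v.intValuation (p : R) ≤ exp (-((1 : ℕ) : ℤ)) :=
    (HeightOneSpectrum.intValuation_le_pow_iff_mem v (p : R) 1).mpr (by rw [hvP, pow_one]; exact hpP)
  have h2 : ¬ v.intValuation (p : R) ≤ exp (-((2 : ℕ) : ℤ)) := by
    rw [HeightOneSpectrum.intValuation_le_pow_iff_mem v (p : R) 2, hvP]
    exact hpP2
  have hne : v.intValuation (p : R) ≠ 0 := by
    intro h
    apply h2
    rw [h]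
    exact zero_le
  rw [← exp_log hne] at h1 h2 ⊢
  rw [exp_le_exp] at h1 h2
  rw [exp_inj]
  push_cast at h1 h2
  omega

/-- The `P`-adic valuation of `p ^ n` is exactly `exp (-n)`. -/
theorem intValuation_natCast_pow (n : ℕ) :
    (⟨P, hP, hP0⟩ : HeightOneSpectrum R).intValuation ((p : R) ^ n) = exp (-(n : ℤ)) := by
  rw [map_pow, intValuation_natCast_eq hP0 hpP hpP2, ← exp_nsmul, exp_inj]
  simp

/-- `p ^ n ∉ P ^ (n + 1)`: the `P`-adic valuation of `p ^ n` is exactly `n` (ramification index 1). -/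
theorem pow_notMem_pow_succ (n : ℕ) : (p : R) ^ n ∉ P ^ (n + 1) := by
  intro h
  set v : HeightOneSpectrum R := ⟨P, hP, hP0⟩ with hv
  have hvP : v.asIdeal = P := rfl
  have := (HeightOneSpectrum.intValuation_le_pow_iff_mem v ((p : R) ^ n) (n + 1)).mpr
    (by rw [hvP]; exact h)
  rw [intValuation_natCast_pow hP0 hpP hpP2 n, exp_le_exp] at this
  push_cast at this
  omega

end Valuation

section Surjectivity

variable (hP0 : P ≠ ⊥) (hpP : (p : R) ∈ P) (hpP2 : (p : R) ∉ P ^ 2)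
  (hsurj : ∀ x : R, ∃ a : ℤ, x - a ∈ P)
include hP0 hpP hpP2 hsurj

/-- Surjectivity of `ℤ → R ⧸ P ^ n` for every `n`, from surjectivity onto the residue field
(`f = 1`) and `p ∈ P ∖ P ^ 2` (`e = 1`): every class modulo `P ^ n` contains a rational integer.
Induction on `n`, the step being Mathlib's `Ideal.exists_mul_add_mem_pow_succ` applied with
`a = p ^ n ∈ P ^ n ∖ P ^ (n + 1)`. -/
theorem exists_int_sub_mem_pow (n : ℕ) (x : R) : ∃ a : ℤ, x - a ∈ P ^ n := by
  induction n generalizing x with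
  | zero => exact ⟨0, by simp⟩
  | succ n ih =>
    obtain ⟨a₀, ha₀⟩ := ih x
    obtain ⟨d, e, he, hde⟩ := Ideal.exists_mul_add_mem_pow_succ hP0 ((p : R) ^ n) (x - a₀)
      (Ideal.pow_mem_pow hpP n) (pow_notMem_pow_succ hP0 hpP hpP2 n) ha₀
    obtain ⟨b, hb⟩ := hsurj d
    refine ⟨a₀ + p ^ n * b, ?_⟩
    have hx : x - ((a₀ + p ^ n * b : ℤ) : R) = (p : R) ^ n * (d - b) + e := by
      push_cast
      linear_combination (-1 : R) * hde
    rw [hx]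
    refine Ideal.add_mem _ ?_ he
    rw [pow_succ]
    exact Ideal.mul_mem_mul (Ideal.pow_mem_pow hpP n) hb

end Surjectivity

section Kernel

variable [hp : Fact p.Prime] (hP0 : P ≠ ⊥) (hpP : (p : R) ∈ P) (hpP2 : (p : R) ∉ P ^ 2)
include hP0 hpP hpP2

/-- The kernel of `ℤ → R ⧸ P ^ n` is `p ^ n ℤ`: for a rational integer `a`,
`(a : R) ∈ P ^ n ↔ p ^ n ∣ a`. Induction on `n`; the step uses a Bézout relation for `p` and the
cofactor and `pow_notMem_pow_succ`. -/
theorem intCast_mem_pow_iff (a : ℤ) (n : ℕ) : ((a : ℤ) : R) ∈ P ^ n ↔ (p : ℤ) ^ n ∣ a := by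
  induction n with
  | zero => simp
  | succ n ih =>
    constructor
    · intro h
      have h' : ((a : ℤ) : R) ∈ P ^ n := Ideal.pow_le_pow_right (Nat.le_succ n) h
      obtain ⟨b, rfl⟩ := ih.mp h'
      have hpb : (p : ℤ) ∣ b := by
        by_contra hnb
        have hcop : IsCoprime (p : ℤ) b :=
          (Irreducible.coprime_iff_not_dvd (Nat.prime_iff_prime_int.mp hp.out).irreducible).mpr hnb
        obtain ⟨u, w, huw⟩ := hcop
        apply pow_notMem_pow_succ hP0 hpP hpP2 n
        have huwR : (u : R) * (p : R) + (w : R) * (b : R) = 1 := by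
          have := congrArg (Int.cast : ℤ → R) huw
          push_cast at this
          exact this
        have key : (p : R) ^ n = (u : R) * (p : R) ^ (n + 1) + (w : R) * ((p : R) ^ n * (b : R)) := by
          linear_combination (-((p : R) ^ n)) * huwR
        rw [key]
        refine Ideal.add_mem _ (Ideal.mul_mem_left _ _ (Ideal.pow_mem_pow hpP (n + 1))) ?_
        refine Ideal.mul_mem_left _ _ ?_
        have h'' : (((p : ℤ) ^ n * b : ℤ) : R) ∈ P ^ (n + 1) := h
        push_cast at h''
        exact h''
      obtain ⟨c, rfl⟩ := hpb
      exact ⟨c, by ring⟩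
    · rintro ⟨c, rfl⟩
      push_cast
      exact Ideal.mul_mem_right _ _ (Ideal.pow_mem_pow hpP (n + 1))

/-- `R ⧸ P ^ n` has characteristic `p ^ n`. -/
theorem charP_quot_pow (n : ℕ) : CharP (R ⧸ P ^ n) (p ^ n) where
  cast_eq_zero_iff x := by
    rw [← map_natCast (Ideal.Quotient.mk (P ^ n)), Ideal.Quotient.eq_zero_iff_mem,
      ← Int.cast_natCast, intCast_mem_pow_iff hP0 hpP hpP2 (x : ℤ) n]
    exact_mod_cast Int.natCast_dvd_natCast

/-- The canonical ring map `ZMod (p ^ n) →+* R ⧸ P ^ n` (reduction of rational integers modulo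
`P ^ n`), Mathlib's `ZMod.castHom` for the characteristic `p ^ n` of `R ⧸ P ^ n`. -/
noncomputable def zmodToQuot (n : ℕ) : ZMod (p ^ n) →+* R ⧸ P ^ n :=
  haveI := charP_quot_pow hP0 hpP hpP2 n
  ZMod.castHom (dvd_refl (p ^ n)) (R ⧸ P ^ n)

/-- `zmodToQuot` sends the class of `a : ℤ` to the class of `(a : R)`. -/
theorem zmodToQuot_intCast (n : ℕ) (a : ℤ) :
    zmodToQuot hP0 hpP hpP2 n (a : ZMod (p ^ n)) = Ideal.Quotient.mk (P ^ n) (a : R) := by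
  rw [zmodToQuot, map_intCast, ← map_intCast (Ideal.Quotient.mk (P ^ n))]

/-- `zmodToQuot` is injective: the kernel of `ℤ → R ⧸ P ^ n` is `p ^ n ℤ`. -/
theorem zmodToQuot_injective (n : ℕ) : Function.Injective (zmodToQuot hP0 hpP hpP2 n) := by
  rw [injective_iff_map_eq_zero]
  intro x hx
  obtain ⟨a, rfl⟩ := ZMod.intCast_surjective x
  rw [zmodToQuot_intCast, Ideal.Quotient.eq_zero_iff_mem, intCast_mem_pow_iff hP0 hpP hpP2] at hx
  rw [ZMod.intCast_zmod_eq_zero_iff_dvd]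
  exact_mod_cast hx

end Kernel

section Equiv

variable [hp : Fact p.Prime] (hP0 : P ≠ ⊥) (hpP : (p : R) ∈ P) (hpP2 : (p : R) ∉ P ^ 2)
  (hsurj : ∀ x : R, ∃ a : ℤ, x - a ∈ P)
include hP0 hpP hpP2 hsurj

/-- `zmodToQuot` is surjective: every class modulo `P ^ n` contains a rational integer. -/
theorem zmodToQuot_surjective (n : ℕ) : Function.Surjective (zmodToQuot hP0 hpP hpP2 n) := by
  intro y
  obtain ⟨x, rfl⟩ := Ideal.Quotient.mk_surjective y
  obtain ⟨a, ha⟩ := exists_int_sub_mem_pow hP0 hpP hpP2 hsurj n x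
  refine ⟨a, ?_⟩
  rw [zmodToQuot_intCast, Ideal.Quotient.eq]
  have := neg_mem ha
  rwa [neg_sub] at this

/-- `zmodToQuot` is bijective. -/
theorem zmodToQuot_bijective (n : ℕ) : Function.Bijective (zmodToQuot hP0 hpP hpP2 n) :=
  ⟨zmodToQuot_injective hP0 hpP hpP2 n, zmodToQuot_surjective hP0 hpP hpP2 hsurj n⟩

/-- THE FINITE LAYERS: at a degree-one prime, `R ⧸ P ^ n ≃+* ZMod (p ^ n)` for every `n`
(the inverse of the reduction map `zmodToQuot`). -/
noncomputable def quotPowEquivZMod (n : ℕ) : R ⧸ P ^ n ≃+* ZMod (p ^ n) :=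
  (RingEquiv.ofBijective (zmodToQuot hP0 hpP hpP2 n) (zmodToQuot_bijective hP0 hpP hpP2 hsurj n)).symm

/-- `quotPowEquivZMod` sends the class of `(a : R)` to `(a : ZMod (p ^ n))`. -/
theorem quotPowEquivZMod_mk_intCast (n : ℕ) (a : ℤ) :
    quotPowEquivZMod hP0 hpP hpP2 hsurj n (Ideal.Quotient.mk (P ^ n) (a : R)) = (a : ZMod (p ^ n)) := by
  rw [quotPowEquivZMod, RingEquiv.symm_apply_eq, RingEquiv.ofBijective_apply, zmodToQuot_intCast]

/-- The inverse sends `(a : ZMod (p ^ n))` to the class of `(a : R)`. -/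
theorem quotPowEquivZMod_symm_intCast (n : ℕ) (a : ℤ) :
    (quotPowEquivZMod hP0 hpP hpP2 hsurj n).symm (a : ZMod (p ^ n)) =
      Ideal.Quotient.mk (P ^ n) (a : R) := by
  rw [RingEquiv.symm_apply_eq, quotPowEquivZMod_mk_intCast]

/-- `|R ⧸ P ^ n| = p ^ n` (no `Module.Free ℤ R` needed). -/
theorem natCard_quot_pow (n : ℕ) : Nat.card (R ⧸ P ^ n) = p ^ n := by
  rw [Nat.card_congr (quotPowEquivZMod hP0 hpP hpP2 hsurj n).toEquiv, Nat.card_zmod]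

/-- `R ⧸ P ^ n` is finite. -/
theorem finite_quot_pow (n : ℕ) : Finite (R ⧸ P ^ n) :=
  Finite.of_equiv _ (quotPowEquivZMod hP0 hpP hpP2 hsurj n).toEquiv.symm

end Equiv

section Bridge

variable [hp : Fact p.Prime]

omit [IsDedekindDomain R] hP hp in
/-- `p ∈ P` when `P` lies over `p ℤ` (Mathlib's `Ideal.LiesOver`). -/
theorem natCast_mem_of_liesOver [P.LiesOver (Ideal.span {(p : ℤ)})] : (p : R) ∈ P := by
  have h : (p : ℤ) ∈ P.under ℤ := by
    rw [← Ideal.over_def P (Ideal.span {(p : ℤ)})]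
    exact Ideal.mem_span_singleton_self _
  rw [Ideal.under, Ideal.mem_comap] at h
  simpa using h

/-- Ramification index `1` in Mathlib's vocabulary (`P.ramificationIdx ℤ = 1`, the new
length-based definition, equal to the multiplicity of `P` in `p R` by
`Ideal.IsDedekindDomain.ramificationIdx_eq_multiplicity`) gives `p ∉ P ^ 2`. -/
theorem not_mem_sq_of_ramificationIdx_eq_one [CharZero R] [P.LiesOver (Ideal.span {(p : ℤ)})]
    (hP0 : P ≠ ⊥) (he : P.ramificationIdx ℤ = 1) : (p : R) ∉ P ^ 2 := by
  intro h
  have hmap : (Ideal.span {(p : ℤ)}).map (algebraMap ℤ R) = Ideal.span {(p : R)} := by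
    rw [Ideal.map_span, Set.image_singleton, map_natCast]
  have hne : (Ideal.span {(p : ℤ)}).map (algebraMap ℤ R) ≠ ⊥ := by
    rw [hmap, Ne, Ideal.span_singleton_eq_bot]
    exact Nat.cast_ne_zero.mpr hp.out.ne_zero
  have hmult := Ideal.IsDedekindDomain.ramificationIdx_eq_multiplicity (Ideal.span {(p : ℤ)}) P hne
  rw [he] at hmult
  have hfin : FiniteMultiplicity P ((Ideal.span {(p : ℤ)}).map (algebraMap ℤ R)) :=
    FiniteMultiplicity.of_prime_left (Ideal.prime_of_isPrime hP0 hP) hne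
  have h2 := (hfin.multiplicity_eq_iff.mp hmult.symm).2
  apply h2
  rw [hmap, Ideal.dvd_span_singleton]
  exact h

omit [IsDedekindDomain R] in
/-- Inertia degree `1` in Mathlib's vocabulary (`P.inertiaDeg ℤ = 1`, the residue-field degree)
gives surjectivity of `ℤ → R ⧸ P`: every class of the residue field contains a rational integer. -/
theorem exists_int_sub_mem_of_inertiaDeg_eq_one [P.LiesOver (Ideal.span {(p : ℤ)})] [P.IsMaximal]
    (hf : P.inertiaDeg ℤ = 1) (x : R) : ∃ a : ℤ, x - a ∈ P := by
  haveI : (Ideal.span {(p : ℤ)}).IsMaximal :=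
    PrincipalIdealRing.isMaximal_of_irreducible (Nat.prime_iff_prime_int.mp hp.out).irreducible
  rw [Ideal.inertiaDeg_eq_of_isMaximal (Ideal.span {(p : ℤ)}) P] at hf
  letI : Field (ℤ ⧸ Ideal.span {(p : ℤ)}) := Ideal.Quotient.field _
  obtain ⟨c, hc⟩ := (finrank_eq_one_iff_of_nonzero' (1 : R ⧸ P) one_ne_zero).mp hf
    (Ideal.Quotient.mk P x)
  obtain ⟨a, rfl⟩ := Ideal.Quotient.mk_surjective c
  refine ⟨a, ?_⟩
  rw [Algebra.smul_def, mul_one, Ideal.Quotient.algebraMap_mk_of_liesOver, Ideal.Quotient.eq] at hc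
  have := neg_mem hc
  rw [neg_sub] at this
  simpa using this

end Bridge

end Summit.Ventures.HodgeRepro2.T5DegreeOneQuotient
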